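import Literature.RingTheory.LocalCohomology.CechDepth
import Literature.AlgebraicGeometry.Resolution.CohenMacaulayUnmixed
import Mathlib.Algebra.Module.FinitePresentation
import Mathlib.RingTheory.Localization.AtPrime.Basic
import Mathlib.RingTheory.Localization.Ideal
import HarnessLib

/-!
# Finiteness of `H²_𝔪(J)` for an ideal invertible on the punctured spectrum

Topic `Literature/RingTheory/LocalCohomology`, sequel of `CechComplex.lean`, `CechTorsion.lean`,
`CechDepth.lean`. For the extended Čech complex `Č(y; M)` we write `Z¹ = ker(Č¹ → Č²)`,
`B¹ = im(Č⁰ → Č¹)` and `H² M := Z¹/B¹` (the local cohomology in cohomological position `2`,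
i.e. `H²_{(y)}(M)` when `depth` permits the Čech computation).

**Main theorem** (`Module.finite_H2_ideal`, a special case of Grothendieck's finiteness theorem
SGA 2 VIII 2.3, proved here by an elementary argument): let `R` be Noetherian local with an
`R`-regular sequence of length `≥ 3` in `𝔪 ⊆ √(y)`, and `J ⊆ R` an ideal containing a regular
element, principal at every non-maximal prime and `𝔪`-saturated. Then `H²(J)` is a finitely
generated `R`-module. Proof:
* the *trace ideal* `τ(J) = Σ_{φ ∈ Hom(J,R)} φ(J)` kills `H²(J)` (`smul_H2_eq_zero_of_hom`:
  multiplication by `φ(j)` on `J` factors through `R`, and `H²(R) = 0` by depth `≥ 3`,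
  `cech_exact_of_isRegular`), and is `𝔪`-primary (`exists_pow_maximalIdeal_le_span_hom`: at a
  non-maximal prime `Q`, `J_Q = (a)` with `a` regular and the isomorphism `J_Q ≅ R_Q` lifts to
  `Hom_R(J, R)` up to a unit — Mathlib's `Module.FinitePresentation.exists_lift_of_isLocalizedModule`);
* for `x ∈ 𝔪` regular on `R` and on `R/J` (`exists_isSMulRegular_both`, prime avoidance in the
  form of Mathlib's `IsSMulRegular.subsingleton_linearMap_iff`), the `x`-torsion of `H²(J)` is
  parametrised by the cocycles `Z⁰(J/xJ)` (`exists_sub_sum_smul_mem_range`, a diagram chase in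
  `0 → Č(J) →x Č(J) → Č(J/xJ) → 0`), and `Z⁰(J/xJ) ↪ Z⁰(R/xR) ≅ R/xR` is Noetherian
  (`finite_ker_dC_zero_of_injective`, using `J/xJ ↪ R/xR` and depth `R/xR ≥ 2` via
  `Literature.AlgebraicGeometry.Resolution.exists_isRegular_quotSMulTop`);
* a module killed by `x^c` with finitely generated `x`-torsion is finitely generated
  (`Module.finite_of_pow_smul_eq_zero`).

Everything is proved; no named facts. This is the finiteness input for the Mittag-Leffler step of
Grothendieck's parafactoriality theorem SGA 2 XI 3.13 (ii)
(`Literature/RingTheory/RegularLocalRing/GrothendieckSamuelHypersurface*`).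

## References

* [Grothendieck1968SGA2] A. Grothendieck, SGA 2, Exp. VIII, Thm. 2.3 and Cor. 2.4 (finiteness of
  `H^i_𝔪`), Exp. III 3.1–3.3 (arXiv:math/0511279).
* [Eisenbud2005] D. Eisenbud, *The Geometry of Syzygies*, GTM 229, Appendix 1, Thm. A1.3.
-/

noncomputable section

open CategoryTheory AlgebraicTopology

universe u

namespace Literature.RingTheory.LocalCohomology

variable {R : Type u} [CommRing R] {s : ℕ} (y : Fin s → R) (M : Type u) [AddCommGroup M]
  [Module R M]

/-! ## Finiteness of `H²` for ideals (brick F): the connecting map from `Z⁰(J/xJ)` -/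

section Connecting

variable {y M}

open Pointwise

/-- The position-`2` cocycles `Z¹ = ker (Č⁰ → Č¹ → Č²)` hmm: cocycles in `Č^1`. [folklore] -/
abbrev Z1 : Submodule R (CechObj y M 1) := LinearMap.ker (dC (y := y) (M := M) 1)

/-- The coboundaries `B¹ = im(Č⁰ → Č¹)`, as a submodule of `Z¹`. [folklore] -/
abbrev B1 : Submodule R (Z1 (y := y) (M := M)) :=
  (LinearMap.range (dC (y := y) (M := M) 0)).comap (Z1 (y := y) (M := M)).subtype

/-- Coboundaries are cocycles. [folklore] -/
theorem dC_mem_Z1 (w : CechObj y M 0) : dC 0 w ∈ Z1 (y := y) (M := M) := by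
  simp [LinearMap.mem_ker, dC_dC]

/-- The second Čech cohomology `H² = Z¹/B¹` of the extended complex (position `2`). [folklore] -/
abbrev H2 : Type u := (Z1 (y := y) (M := M)) ⧸ B1 (y := y) (M := M)

/-- The class of a cocycle. [folklore] -/
abbrev H2.mk (z : CechObj y M 1) (hz : dC 1 z = 0) : H2 (y := y) (M := M) :=
  (B1 (y := y) (M := M)).mkQ ⟨z, hz⟩

/-- A class vanishes iff the cocycle is a coboundary. [folklore] -/
theorem H2.mk_eq_zero_iff (z : CechObj y M 1) (hz : dC 1 z = 0) :
    H2.mk z hz = 0 ↔ ∃ w : CechObj y M 0, dC 0 w = z := by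
  simp [Submodule.Quotient.mk_eq_zero, B1, LinearMap.mem_range]

/-- **The connecting map is onto the `x`-torsion of `H²`**: if `x` is `M`-regular and the class of
the cocycle `z` is killed by `x` (`x z = d w`), then `w` reduces to a cocycle `w̄ ∈ Z⁰(M/xM)`, and
conversely every cocycle of `Z⁰(M/xM)` lifts to such a pair; here the useful half: the
`x`-torsion classes are parametrised by `Z⁰(M/xM)`. Concretely: for every cocycle
`c̄ ∈ Z⁰(M/xM)` there is a cocycle `z` with `x z = d c` for a lift `c`, and every `x`-torsion
class arises this way. [folklore] -/
theorem exists_cocycle_of_Z0_quot {x : R} (hx : IsSMulRegular M x)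
    (cbar : CechObj y (QuotSMulTop x M) 0) (hc : dC 0 cbar = 0) :
    ∃ (c : CechObj y M 0) (z : CechObj y M 1), cechObjMap y (toQuot x) 0 c = cbar ∧
      dC 0 c = x • z ∧ dC 1 z = 0 := by
  obtain ⟨c, rfl⟩ := cechObjMap_surjective y (toQuot x) (toQuot_surjective x) 0 cbar
  have h1 : cechObjMap y (toQuot x) 1 (dC 0 c) = 0 := by rw [← dC_cechObjMap, hc]
  obtain ⟨z, hz⟩ := exists_eq_smul_of_cechObjMap_toQuot_eq_zero x 1 _ h1
  refine ⟨c, z, rfl, hz, ?_⟩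
  apply isSMulRegular_cechObj hx 2
  dsimp only
  rw [smul_zero, ← LinearMap.map_smul, ← hz, dC_dC]

/-- The `x`-torsion classes of `H²(M)` come from `Z⁰(M/xM)`: if `x [z] = 0` then `z` differs by
a coboundary from a cocycle `z'` with `x z' = d c`, `c̄ ∈ Z⁰(M/xM)`. (In fact `z' = z`.) [folklore] -/
theorem dC_cechObjMap_toQuot_eq_zero_of_smul_eq_dC {x : R} (z : CechObj y M 1)
    (w : CechObj y M 0) (hw : x • z = dC 0 w) :
    dC 0 (cechObjMap y (toQuot x) 0 w) = 0 := by
  rw [dC_cechObjMap, ← hw, LinearMap.map_smul, smul_cechObj_quot]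

end Connecting

/-! ### The `x`-torsion of `H²(M)` is controlled by `Z⁰(M/xM)` -/

section TorsionH2

variable {y M}

open Pointwise

/-- **`x`-torsion classes are combinations of lifted classes.** Let `x` be `M`-regular and let
the cocycles `c̄_l ∈ Z⁰(M/xM)` (`l < r`) generate `Z⁰(M/xM)`; choose lifts `c_l` and the cocycles
`z_l` with `d c_l = x z_l` (`exists_cocycle_of_Z0_quot`). Then every cocycle `z` whose class is
killed by `x` (`x z = d w`) is, up to a coboundary, a combination of the `z_l`. [folklore] -/
theorem exists_sub_sum_smul_mem_range {x : R} (hx : IsSMulRegular M x) {r : ℕ}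
    (cbar : Fin r → CechObj y (QuotSMulTop x M) 0)
    (hgen : ∀ c' : CechObj y (QuotSMulTop x M) 0, dC 0 c' = 0 →
      c' ∈ Submodule.span R (Set.range cbar))
    (c : Fin r → CechObj y M 0) (z : Fin r → CechObj y M 1)
    (hc : ∀ l, cechObjMap y (toQuot x) 0 (c l) = cbar l) (hcz : ∀ l, dC 0 (c l) = x • z l)
    (zz : CechObj y M 1) (w : CechObj y M 0) (hw : x • zz = dC 0 w) :
    ∃ (a : Fin r → R) (w' : CechObj y M 0), zz = ∑ l, a l • z l + dC 0 w' := by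
  classical
  -- `w̄` is a cocycle, hence a combination of the `c̄_l`
  have hwbar : dC 0 (cechObjMap y (toQuot x) 0 w) = 0 :=
    dC_cechObjMap_toQuot_eq_zero_of_smul_eq_dC zz w hw
  obtain ⟨a, ha⟩ := (Submodule.mem_span_range_iff_exists_fun R).mp (hgen _ hwbar)
  -- `w - Σ a_l c_l` dies mod `x`, so equals `x w'`
  have h1 : cechObjMap y (toQuot x) 0 (w - ∑ l, a l • c l) = 0 := by
    rw [map_sub, map_sum, sub_eq_zero, ← ha]
    exact Finset.sum_congr rfl fun l _ => by rw [LinearMap.map_smul, hc l]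
  obtain ⟨w', hw'⟩ := exists_eq_smul_of_cechObjMap_toQuot_eq_zero x 0 _ h1
  refine ⟨a, w', ?_⟩
  apply isSMulRegular_cechObj hx 1
  dsimp only
  rw [hw, smul_add, Finset.smul_sum, ← LinearMap.map_smul, ← hw', map_sub, map_sum]
  simp only [LinearMap.map_smul, hcz, smul_comm x]
  abel

end TorsionH2

/-! ### `Z⁰` of a submodule of a depth-`≥ 2` module is finitely generated -/

section Z0Finite

variable {y M}

/-- If `ι : N → P` is injective and the extended Čech complex of `P` is exact in degrees `0, 1`
(`P → Č⁰(P)` injective with image the cocycles), then `Z⁰(N)` embeds `R`-linearly into `P`; in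
particular it is finitely generated when `P` is a Noetherian module. [folklore] -/
theorem finite_ker_dC_zero_of_injective {N P : Type u} [AddCommGroup N] [Module R N]
    [AddCommGroup P] [Module R P] [IsNoetherian R P] (ι : N →ₗ[R] P) (hι : Function.Injective ι)
    (hP0 : ∀ p : P, cechAug y P p = 0 → p = 0)
    (hP1 : ∀ c : CechObj y P 0, dC 0 c = 0 → ∃ p : P, cechAug y P p = c) :
    Module.Finite R (LinearMap.ker (dC (y := y) (M := N) 0)) := by
  classical
  -- the map `Z⁰(N) → P`
  have hmem : ∀ c : LinearMap.ker (dC (y := y) (M := N) 0),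
      ∃ p : P, cechAug y P p = cechObjMap y ι 0 c := by
    intro c
    apply hP1
    rw [dC_cechObjMap, (LinearMap.mem_ker.mp c.2), map_zero]
  choose f hf using hmem
  have hinj : Function.Injective (cechAug y P) := fun p q h => by
    have := hP0 (p - q) (by rw [map_sub, h, sub_self])
    exact sub_eq_zero.mp this
  have hf_add : ∀ c c', f (c + c') = f c + f c' := fun c c' =>
    hinj (by rw [map_add, hf, hf, hf, Submodule.coe_add, map_add])
  have hf_smul : ∀ (r : R) c, f (r • c) = r • f c := fun r c =>
    hinj (by rw [LinearMap.map_smul, hf, hf, Submodule.coe_smul, LinearMap.map_smul])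
  let F : LinearMap.ker (dC (y := y) (M := N) 0) →ₗ[R] P :=
    { toFun := f, map_add' := hf_add, map_smul' := hf_smul }
  have hF : Function.Injective F := by
    intro c c' h
    have : cechObjMap y ι 0 c = cechObjMap y ι 0 c' := by rw [← hf, ← hf]; exact congrArg _ h
    exact Subtype.ext (cechObjMap_injective y ι hι 0 this)
  exact Module.Finite.of_injective F hF

end Z0Finite

/-! ### A module killed by `x^c` with finitely generated `x`-torsion is finitely generated -/

section PowTorsion

/-- If `x^c` kills the `R`-module `E` (`R` Noetherian) and the `x`-torsion `{e | x e = 0}` is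
finitely generated, then `E` is finitely generated (induction on `c` along `0 → E[x] → E → xE → 0`).
[folklore] -/
theorem Module.finite_of_pow_smul_eq_zero [IsNoetherianRing R] :
    ∀ (c : ℕ) (E : Type u) [AddCommGroup E] [Module R E] (x : R),
      (∀ e : E, x ^ c • e = 0) → (LinearMap.ker (LinearMap.lsmul R E x)).FG → Module.Finite R E := by
  intro c
  induction c with
  | zero =>
    intro E _ _ x hc _
    have : Subsingleton E := ⟨fun a b => by
      have ha := hc a; have hb := hc b
      simp only [pow_zero, one_smul] at ha hb
      rw [ha, hb]⟩
    infer_instance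
  | succ c ih =>
    intro E _ _ x hc hT
    set f : E →ₗ[R] E := LinearMap.lsmul R E x with hfdef
    -- the image `xE` satisfies the hypotheses with exponent `c`
    set F : Submodule R E := LinearMap.range f with hF
    have hFc : ∀ e : F, x ^ c • e = 0 := by
      rintro ⟨_, e, rfl⟩
      apply Subtype.ext
      change x ^ c • f e = 0
      rw [hfdef, LinearMap.lsmul_apply, ← mul_smul, ← pow_succ, hc]
    have hFT : (LinearMap.ker (LinearMap.lsmul R F x)).FG := by
      -- it is (isomorphic to) a submodule of the f.g. module `ker (x •)`
      haveI : IsNoetherian R (LinearMap.ker f) := isNoetherian_of_fg_of_noetherian _ hT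
      let g : LinearMap.ker (LinearMap.lsmul R F x) →ₗ[R] LinearMap.ker f :=
        { toFun := fun e => ⟨(e.1 : E), by
            have := e.2
            rw [LinearMap.mem_ker, LinearMap.lsmul_apply] at this
            rw [LinearMap.mem_ker, hfdef, LinearMap.lsmul_apply]
            exact congrArg Subtype.val this⟩
          map_add' := fun _ _ => rfl
          map_smul' := fun _ _ => rfl }
      have hg : Function.Injective g := fun a b h => by
        apply Subtype.ext; apply Subtype.ext
        exact congrArg (fun e : LinearMap.ker f => (e : E)) h
      have : Module.Finite R (LinearMap.ker (LinearMap.lsmul R F x)) := Module.Finite.of_injective g hg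
      exact Module.Finite.iff_fg.mp this
    have hFfin : Module.Finite R F := ih F x hFc hFT
    -- `E` is an extension of `xE` by `E[x]`
    have htop : (⊤ : Submodule R E).FG := by
      apply Submodule.fg_of_fg_map_of_fg_inf_ker f
      · rw [Submodule.map_top]
        exact Module.Finite.iff_fg.mp hFfin
      · rw [top_inf_eq]
        exact hT
    exact Module.finite_def.mpr htop

end PowTorsion

/-! ### Finiteness of `H²(M)` from finiteness of `Z⁰(M/xM)` -/

section H2Finite

variable {y M}

open Pointwise

/-- **Finiteness of `H²`.** Let `R` be Noetherian, `x` an `M`-regular element such that `x^c`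
kills `H²(M) = Z¹/B¹` (position `2` of the extended Čech complex) and such that the cocycles
`Z⁰(M/xM)` form a finitely generated module. Then `H²(M)` is finitely generated: its `x`-torsion is
generated by the classes `[z_l]` attached to generators `c̄_l` of `Z⁰(M/xM)`
(`exists_sub_sum_smul_mem_range`), and `Module.finite_of_pow_smul_eq_zero` concludes. [folklore] -/
theorem Module.finite_H2 [IsNoetherianRing R] {x : R} (hx : IsSMulRegular M x)
    (hZ0 : Module.Finite R (LinearMap.ker (dC (y := y) (M := QuotSMulTop x M) 0)))
    (c : ℕ) (hc : ∀ e : H2 (y := y) (M := M), x ^ c • e = 0) :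
    Module.Finite R (H2 (y := y) (M := M)) := by
  classical
  -- generators of `Z⁰(M/xM)` and their lifts
  obtain ⟨r, gen, hgen⟩ := Module.Finite.exists_fin (R := R)
    (M := LinearMap.ker (dC (y := y) (M := QuotSMulTop x M) 0))
  set cbar : Fin r → CechObj y (QuotSMulTop x M) 0 := fun l => (gen l : CechObj y (QuotSMulTop x M) 0)
    with hcbar
  have hgen' : ∀ c' : CechObj y (QuotSMulTop x M) 0, dC 0 c' = 0 →
      c' ∈ Submodule.span R (Set.range cbar) := by
    intro c' hc'
    have hmem : (⟨c', hc'⟩ : LinearMap.ker (dC (y := y) (M := QuotSMulTop x M) 0)) ∈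
        Submodule.span R (Set.range gen) := by rw [hgen]; trivial
    have := Submodule.mem_map_of_mem (f := (LinearMap.ker (dC (y := y) (M := QuotSMulTop x M) 0)).subtype) hmem
    rw [Submodule.map_span, ← Set.range_comp] at this
    exact this
  have hlift := fun l => exists_cocycle_of_Z0_quot (y := y) hx (cbar l) (gen l).2
  choose cl zl hcl hczl hzl using hlift
  -- the `x`-torsion of `H²` is contained in the span of the `[z_l]`
  set S : Submodule R (H2 (y := y) (M := M)) :=
    Submodule.span R (Set.range fun l => H2.mk (zl l) (hzl l)) with hS
  have hT : LinearMap.ker (LinearMap.lsmul R (H2 (y := y) (M := M)) x) ≤ S := by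
    intro e he
    rw [LinearMap.mem_ker, LinearMap.lsmul_apply] at he
    obtain ⟨⟨zz, hzz⟩, rfl⟩ := Submodule.Quotient.mk_surjective _ e
    -- `x • [zz] = 0` means `x zz` is a coboundary
    have hxzz : ∃ w : CechObj y M 0, dC 0 w = x • zz := by
      have h1 : (B1 (y := y) (M := M)).mkQ ⟨x • zz, Submodule.smul_mem _ x hzz⟩ = 0 := by
        rw [← he]; rfl
      rw [Submodule.mkQ_apply, Submodule.Quotient.mk_eq_zero] at h1
      simpa [B1, LinearMap.mem_range] using h1
    obtain ⟨w, hw⟩ := hxzz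
    obtain ⟨a, w', hzz'⟩ := exists_sub_sum_smul_mem_range hx cbar hgen' cl zl hcl hczl zz w hw.symm
    -- hence `[zz] = Σ a_l [z_l]`
    have : (Submodule.Quotient.mk ⟨zz, hzz⟩ : H2 (y := y) (M := M)) =
        ∑ l, a l • H2.mk (zl l) (hzl l) := by
      have hsum : (⟨zz, hzz⟩ : Z1 (y := y) (M := M)) =
          ∑ l, a l • ⟨zl l, hzl l⟩ + ⟨dC 0 w', dC_mem_Z1 w'⟩ := by
        apply Subtype.ext
        simp only [Submodule.coe_add, Submodule.coe_sum, Submodule.coe_smul]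
        exact hzz'
      rw [hsum, Submodule.Quotient.mk_add, ← Submodule.mkQ_apply, map_sum]
      have h0 : (Submodule.Quotient.mk (⟨dC 0 w', dC_mem_Z1 w'⟩ : Z1 (y := y) (M := M)) :
          H2 (y := y) (M := M)) = 0 := by
        rw [Submodule.Quotient.mk_eq_zero]
        simp [B1, LinearMap.mem_range]
      rw [h0, add_zero]
      refine Finset.sum_congr rfl fun l _ => ?_
      rw [LinearMap.map_smul]
    rw [this]
    exact Submodule.sum_mem _ fun l _ => Submodule.smul_mem _ _ (Submodule.subset_span ⟨l, rfl⟩)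
  have hSfg : S.FG := Submodule.fg_span (Set.finite_range _)
  haveI : IsNoetherian R S := isNoetherian_of_fg_of_noetherian _ hSfg
  have hTfin : Module.Finite R (LinearMap.ker (LinearMap.lsmul R (H2 (y := y) (M := M)) x)) :=
    Module.Finite.of_injective (Submodule.inclusion hT) (Submodule.inclusion_injective hT)
  exact Module.finite_of_pow_smul_eq_zero c _ x hc (Module.Finite.iff_fg.mp hTfin)

end H2Finite

/-! ### The trace ideal of an ideal kills its `H²` (given `H²` of the ring vanishes) -/

section Trace

variable {y M}

/-- `Č^n(y; -)` is functorial in the module: composition. [folklore] -/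
theorem cechObjMap_comp {N P : Type u} [AddCommGroup N] [Module R N] [AddCommGroup P] [Module R P]
    (φ : M →ₗ[R] N) (ψ : N →ₗ[R] P) (n : ℕ) :
    cechObjMap y (ψ ∘ₗ φ) n = cechObjMap y ψ n ∘ₗ cechObjMap y φ n := by
  refine LinearMap.ext fun c => funext fun t => ?_
  simp only [cechObjMap_apply, LinearMap.coe_comp, Function.comp_apply, locMap]
  rw [IsLocalizedModule.map_comp' (Submonoid.powers (tupleProd y t))
    (LocalizedModule.mkLinearMap (Submonoid.powers (tupleProd y t)) M)
    (LocalizedModule.mkLinearMap (Submonoid.powers (tupleProd y t)) N)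
    (LocalizedModule.mkLinearMap (Submonoid.powers (tupleProd y t)) P) φ ψ]
  rfl

/-- For an ideal `J` of `R` and an `R`-linear `φ : J → R`, `φ(b) j = φ(j) b` (`b, j ∈ J`): the
endomorphism `b ↦ φ(b) • j` of `J` is multiplication by `φ(j)`. [folklore] -/
theorem toSpan_comp_eq_smul_id (J : Ideal R) (φ : J →ₗ[R] R) (j : J) :
    (LinearMap.toSpanSingleton R J j) ∘ₗ φ = (φ j) • (LinearMap.id : J →ₗ[R] J) := by
  ext b
  simp only [LinearMap.coe_comp, Function.comp_apply, LinearMap.toSpanSingleton_apply,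
    LinearMap.smul_apply, LinearMap.id_apply, Submodule.coe_smul, smul_eq_mul]
  -- `φ b * j = φ j * b`: apply `φ` to `(j : R) • b = (b : R) • j`
  have h : ((j : R) • b : J) = (b : R) • j := by
    apply Subtype.ext
    simp [mul_comm]
  have := congrArg φ h
  rw [LinearMap.map_smul, LinearMap.map_smul, smul_eq_mul, smul_eq_mul] at this
  -- this : ↑j * φ b = ↑b * φ j
  rw [mul_comm, this, mul_comm]

/-- **The trace ideal kills `H²(J)`**: if the extended Čech complex of `R` is exact at `Č¹`
(every `1`-cocycle of `R` is a coboundary, e.g. `depth R ≥ 3`), then for every ideal `J`, every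
`φ ∈ Hom_R(J, R)` and `j ∈ J`, the element `φ(j)` kills `H²(J) = Z¹(J)/B¹(J)`: multiplication
by `φ(j)` on `J` factors as `J →φ R →(·j) J`, hence on `H²` through `H²(R) = 0`. [folklore] -/
theorem smul_H2_eq_zero_of_hom (hR2 : ∀ z : CechObj y R 1, dC 1 z = 0 → ∃ w : CechObj y R 0, dC 0 w = z)
    (J : Ideal R) (φ : J →ₗ[R] R) (j : J) (e : H2 (y := y) (M := J)) : (φ j) • e = 0 := by
  obtain ⟨⟨z, hz⟩, rfl⟩ := Submodule.Quotient.mk_surjective _ e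
  -- `φ_* z` is a cocycle of `R`, hence a coboundary
  have h1 : dC 1 (cechObjMap y φ 1 z) = 0 := by
    rw [dC_cechObjMap, (LinearMap.mem_ker.mp hz), map_zero]
  obtain ⟨w, hw⟩ := hR2 _ h1
  -- push forward along `r ↦ r • j`
  have key : (φ j) • z = dC 0 (cechObjMap y (LinearMap.toSpanSingleton R J j) 0 w) := by
    rw [dC_cechObjMap, hw, ← LinearMap.comp_apply, ← cechObjMap_comp, toSpan_comp_eq_smul_id,
      cechObjMap_smul_id, LinearMap.smul_apply, LinearMap.id_apply]
  change (B1 (y := y) (M := J)).mkQ ((φ j) • ⟨z, hz⟩) = 0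
  rw [Submodule.mkQ_apply, Submodule.Quotient.mk_eq_zero]
  simp only [B1, Submodule.mem_comap, Submodule.coe_subtype, LinearMap.mem_range, Submodule.coe_smul]
  exact ⟨_, key.symm⟩

/-- Consequently every element of the ideal generated by the `φ(j)` kills `H²(J)`; in particular
if that ideal contains `x^c` then `x^c` kills `H²(J)`. [folklore] -/
theorem pow_smul_H2_eq_zero_of_mem_span
    (hR2 : ∀ z : CechObj y R 1, dC 1 z = 0 → ∃ w : CechObj y R 0, dC 0 w = z)
    (J : Ideal R) {x : R} {c : ℕ}
    (hx : x ^ c ∈ Ideal.span {r : R | ∃ (φ : J →ₗ[R] R) (j : J), φ j = r})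
    (e : H2 (y := y) (M := J)) : x ^ c • e = 0 := by
  refine Submodule.span_induction (p := fun r _ => r • e = 0) ?_ ?_ ?_ ?_ hx
  · rintro r ⟨φ, j, rfl⟩
    exact smul_H2_eq_zero_of_hom hR2 J φ j e
  · exact zero_smul _ _
  · intro a b _ _ ha hb
    rw [add_smul, ha, hb, add_zero]
  · intro a b _ hb
    rw [smul_eq_mul, mul_smul, hb, smul_zero]

end Trace

/-! ### The trace ideal of an ideal principal on the punctured spectrum is `𝔪`-primary -/

section TracePrimary

/-- **A homomorphism `J → R` not vanishing at `Q`.** If the ideal `J` of `R` contains a regular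
element and `J R_Q` is principal, there are `φ ∈ Hom_R(J, R)` and `j ∈ J` with `φ(j) ∉ Q`:
`J R_Q = (a)` with `a` regular in `R_Q`, the `R_Q`-isomorphism `J R_Q ≅ R_Q` restricted to `J`
lifts (up to a unit `s ∉ Q`) to `φ : J → R` as `J` is finitely presented (Mathlib's
`Module.FinitePresentation.exists_lift_of_isLocalizedModule`), and `φ(a) ≡ s`. [folklore] -/
theorem exists_hom_apply_not_mem [IsNoetherianRing R] (J : Ideal R)
    (hreg : ∃ c ∈ J, c ∈ nonZeroDivisors R) (Q : Ideal R) [Q.IsPrime]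
    (hQ : (J.map (algebraMap R (Localization.AtPrime Q))).IsPrincipal) :
    ∃ (φ : J →ₗ[R] R) (j : J), φ j ∉ Q := by
  classical
  set RQ := Localization.AtPrime Q with hRQ
  -- `J R_Q = (a/1)` with `a ∈ J`
  obtain ⟨g, hg⟩ := hQ
  have hgmem : g ∈ J.map (algebraMap R RQ) := by rw [hg]; exact Ideal.mem_span_singleton_self g
  obtain ⟨⟨⟨a, haJ⟩, sg⟩, hs⟩ := (IsLocalization.mem_map_algebraMap_iff Q.primeCompl RQ).mp hgmem
  simp only at hs
  have hmap : J.map (algebraMap R RQ) = Ideal.span {algebraMap R RQ a} := by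
    rw [hg, ← hs]
    exact (Ideal.span_singleton_mul_right_unit (IsLocalization.map_units RQ sg) g).symm
  -- `a/1` is regular: a regular `c ∈ J` maps to a regular multiple of it
  obtain ⟨c, hcJ, hcreg⟩ := hreg
  have hcQ : ∀ z : RQ, algebraMap R RQ c * z = 0 → z = 0 := by
    intro z hz
    obtain ⟨⟨zn, zd⟩, rfl⟩ := IsLocalization.mk'_surjective Q.primeCompl z
    rw [IsLocalization.mul_mk'_eq_mk'_of_mul, IsLocalization.mk'_eq_zero_iff] at hz
    obtain ⟨u, hu⟩ := hz
    rw [IsLocalization.mk'_eq_zero_iff]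
    refine ⟨u, ?_⟩
    have : c * (u * zn) = 0 := by rw [← hu]; ring
    exact (mul_left_mem_nonZeroDivisors_eq_zero_iff hcreg).mp this |>.symm ▸ rfl
  have haQ : ∀ z : RQ, algebraMap R RQ a * z = 0 → z = 0 := by
    have hcmem : algebraMap R RQ c ∈ Ideal.span {algebraMap R RQ a} := by
      rw [← hmap]; exact Ideal.mem_map_of_mem _ hcJ
    obtain ⟨q, hq⟩ := Ideal.mem_span_singleton'.mp hcmem
    intro z hz
    apply hcQ
    rw [← hq, mul_assoc, hz, mul_zero]
  -- `R_Q ≃ (a/1)` and `g₀ : J → (a/1)`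
  have hinj : Function.Injective (LinearMap.toSpanSingleton RQ RQ (algebraMap R RQ a)) := by
    intro z w h
    simp only [LinearMap.toSpanSingleton_apply, smul_eq_mul] at h
    have : algebraMap R RQ a * (z - w) = 0 := by rw [mul_sub, mul_comm, h, mul_comm, sub_self]
    exact sub_eq_zero.mp (haQ _ this)
  let e : RQ ≃ₗ[RQ] Ideal.span {algebraMap R RQ a} :=
    (LinearEquiv.ofInjective _ hinj).trans
      (LinearEquiv.ofEq _ _ (LinearMap.span_singleton_eq_range RQ RQ (algebraMap R RQ a)).symm)
  have he1 : ∀ (w : RQ) (hw : w ∈ Ideal.span {algebraMap R RQ a}) (z : RQ),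
      z * algebraMap R RQ a = w → e.symm ⟨w, hw⟩ = z := by
    intro w hw z hz
    apply e.injective
    rw [LinearEquiv.apply_symm_apply]
    apply Subtype.ext
    change w = (z • algebraMap R RQ a : RQ)
    rw [smul_eq_mul, hz]
  have hmemJ : ∀ b : J, algebraMap R RQ b ∈ Ideal.span {algebraMap R RQ a} := fun b => by
    rw [← hmap]; exact Ideal.mem_map_of_mem _ b.2
  let g₀ : J →ₗ[R] Ideal.span {algebraMap R RQ a} :=
    { toFun := fun b => ⟨algebraMap R RQ b, hmemJ b⟩
      map_add' := fun b b' => by apply Subtype.ext; simp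
      map_smul' := fun r b => by apply Subtype.ext; simp [Algebra.smul_def] }
  let gg : J →ₗ[R] RQ := (e.symm.toLinearMap.restrictScalars R) ∘ₗ g₀
  -- lift `gg` to `φ : J → R` up to `s ∉ Q` (`J` is finitely presented: Noetherian)
  haveI : Module.Finite R J := Module.IsNoetherian.finite R _
  haveI : Module.FinitePresentation R J := Module.finitePresentation_of_finite R J
  obtain ⟨φ, s, hφ⟩ := Module.FinitePresentation.exists_lift_of_isLocalizedModule Q.primeCompl
    (Algebra.linearMap R RQ) gg
  refine ⟨φ, ⟨a, haJ⟩, fun haQ' => ?_⟩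
  -- `φ(a)/1 = s • gg(a) = s • 1`
  have h1 : gg ⟨a, haJ⟩ = 1 := by
    change e.symm (g₀ ⟨a, haJ⟩) = 1
    exact he1 _ _ 1 (one_mul _)
  have h2 : algebraMap R RQ (φ ⟨a, haJ⟩) = algebraMap R RQ s := by
    have := congrArg (fun f => f ⟨a, haJ⟩) (congrArg DFunLike.coe hφ)
    simp only [LinearMap.coe_comp, Function.comp_apply, Algebra.linearMap_apply, LinearMap.smul_apply,
      h1] at this
    rw [this, Submonoid.smul_def, Algebra.smul_def, mul_one]
  obtain ⟨u, hu⟩ := (IsLocalization.eq_iff_exists Q.primeCompl RQ).mp h2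
  have : (u : R) * s ∈ Q := by rw [← hu]; exact Ideal.mul_mem_left _ _ haQ'
  exact ((inferInstance : Q.IsPrime).mem_or_mem this).elim u.2 s.2

/-- **The trace ideal is `𝔪`-primary**: for a Noetherian local `R` and an ideal `J` containing a
regular element and principal at every non-maximal prime, some power of `𝔪` lies in the ideal
generated by the values `φ(j)`, `φ ∈ Hom_R(J, R)`, `j ∈ J`. [folklore] -/
theorem exists_pow_maximalIdeal_le_span_hom [IsLocalRing R] [IsNoetherianRing R] (J : Ideal R)
    (hreg : ∃ c ∈ J, c ∈ nonZeroDivisors R)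
    (hloc : ∀ (Q : Ideal R) [Q.IsPrime], ¬ Q.IsMaximal →
      (J.map (algebraMap R (Localization.AtPrime Q))).IsPrincipal) :
    ∃ c : ℕ, IsLocalRing.maximalIdeal R ^ c ≤
      Ideal.span {r : R | ∃ (φ : J →ₗ[R] R) (j : J), φ j = r} := by
  set τ : Ideal R := Ideal.span {r : R | ∃ (φ : J →ₗ[R] R) (j : J), φ j = r} with hτ
  have hrad : IsLocalRing.maximalIdeal R ≤ τ.radical := by
    rw [Ideal.radical_eq_sInf]
    refine le_sInf fun Q hQ => ?_
    obtain ⟨hτQ, hQp⟩ := hQ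
    haveI : Q.IsPrime := hQp
    by_cases hQm : Q.IsMaximal
    · exact le_of_eq (IsLocalRing.eq_maximalIdeal hQm).symm
    · obtain ⟨φ, j, hj⟩ := exists_hom_apply_not_mem J hreg Q (hloc Q hQm)
      exact absurd (hτQ (Ideal.subset_span ⟨φ, j, rfl⟩)) hj
  exact Ideal.exists_pow_le_of_le_radical_of_fg hrad (IsNoetherian.noetherian _)

end TracePrimary

/-! ### A regular element for two modules; `J/xJ ↪ R/xR` -/

section TwoModules

/-- If neither `M₁` nor `M₂` has a non-zero element killed by `𝔪` (Noetherian local `R`, finite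
modules), some `x ∈ 𝔪` is regular on both (prime avoidance over `Ass M₁ ∪ Ass M₂`, through
`Hom(k, M₁ × M₂) = 0` and Mathlib's `IsSMulRegular.subsingleton_linearMap_iff`). [folklore] -/
theorem exists_isSMulRegular_both [IsLocalRing R] [IsNoetherianRing R] {M₁ M₂ : Type u}
    [AddCommGroup M₁] [Module R M₁] [Module.Finite R M₁] [AddCommGroup M₂] [Module R M₂]
    [Module.Finite R M₂]
    (h₁ : ∀ m : M₁, (∀ x ∈ IsLocalRing.maximalIdeal R, x • m = 0) → m = 0)
    (h₂ : ∀ m : M₂, (∀ x ∈ IsLocalRing.maximalIdeal R, x • m = 0) → m = 0) :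
    ∃ x ∈ IsLocalRing.maximalIdeal R, IsSMulRegular M₁ x ∧ IsSMulRegular M₂ x := by
  have hsub : Subsingleton ((R ⧸ IsLocalRing.maximalIdeal R) →ₗ[R] (M₁ × M₂)) := by
    refine ⟨fun g g' => ?_⟩
    have key : ∀ g : (R ⧸ IsLocalRing.maximalIdeal R) →ₗ[R] (M₁ × M₂),
        g (Ideal.Quotient.mk _ 1) = 0 := by
      intro g
      have hx : ∀ x ∈ IsLocalRing.maximalIdeal R, x • g (Ideal.Quotient.mk _ 1) = 0 := by
        intro x hx
        rw [← map_smul]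
        have : x • (Ideal.Quotient.mk (IsLocalRing.maximalIdeal R) 1) = 0 := by
          rw [Algebra.smul_def, Ideal.Quotient.algebraMap_eq, ← map_mul, mul_one,
            Ideal.Quotient.eq_zero_iff_mem]
          exact hx
        rw [this, map_zero]
      ext
      · exact congrArg Prod.fst (show g _ = 0 from Prod.ext
          (h₁ _ fun x hx' => by simpa using congrArg Prod.fst (hx x hx'))
          (h₂ _ fun x hx' => by simpa using congrArg Prod.snd (hx x hx')))
      · exact congrArg Prod.snd (show g _ = 0 from Prod.ext
          (h₁ _ fun x hx' => by simpa using congrArg Prod.fst (hx x hx'))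
          (h₂ _ fun x hx' => by simpa using congrArg Prod.snd (hx x hx')))
    ext
    · change (g (Ideal.Quotient.mk _ 1)).1 = (g' (Ideal.Quotient.mk _ 1)).1
      rw [key g, key g']
    · change (g (Ideal.Quotient.mk _ 1)).2 = (g' (Ideal.Quotient.mk _ 1)).2
      rw [key g, key g']
  obtain ⟨r, hr, hreg⟩ := IsSMulRegular.subsingleton_linearMap_iff.mp hsub
  refine ⟨r, ?_, ?_, ?_⟩
  · have h1 := Module.mem_annihilator.mp hr (Ideal.Quotient.mk _ 1)
    rw [Algebra.smul_def, Ideal.Quotient.algebraMap_eq, ← map_mul, mul_one,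
      Ideal.Quotient.eq_zero_iff_mem] at h1
    exact h1
  · intro a b hab
    have := @hreg (a, 0) (b, 0) (by simp only [Prod.smul_mk, smul_zero]; exact congrArg (·, (0 : M₂)) hab)
    exact congrArg Prod.fst this
  · intro a b hab
    have := @hreg (0, a) (0, b) (by simp only [Prod.smul_mk, smul_zero]; exact congrArg ((0 : M₁), ·) hab)
    exact congrArg Prod.snd this

open Pointwise in
/-- If `x` is regular on `R ⧸ J` then `J/xJ → R/xR` is injective (`xR ∩ J = xJ`). [folklore] -/
theorem quotSMulTop_map_subtype_injective (J : Ideal R) {x : R}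
    (hx : IsSMulRegular (R ⧸ J) x) : Function.Injective (QuotSMulTop.map x (Submodule.subtype J)) := by
  rw [injective_iff_map_eq_zero]
  intro m hm
  obtain ⟨m, rfl⟩ := Submodule.mkQ_surjective _ m
  rw [Submodule.mkQ_apply] at hm ⊢
  rw [QuotSMulTop.map_apply_mk, Submodule.Quotient.mk_eq_zero,
    Submodule.mem_smul_pointwise_iff_exists] at hm
  obtain ⟨b, -, hb⟩ := hm
  -- `x b = m ∈ J`, so `b ∈ J`
  have hbJ : b ∈ J := by
    have : x • (Ideal.Quotient.mk J b) = 0 := by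
      rw [Algebra.smul_def, Ideal.Quotient.algebraMap_eq, ← map_mul, Ideal.Quotient.eq_zero_iff_mem,
        ← smul_eq_mul, hb]
      exact m.2
    exact Ideal.Quotient.eq_zero_iff_mem.mp (hx.right_eq_zero_of_smul this)
  rw [Submodule.Quotient.mk_eq_zero, Submodule.mem_smul_pointwise_iff_exists]
  exact ⟨⟨b, hbJ⟩, Submodule.mem_top, Subtype.ext hb⟩

end TwoModules

/-! ### Assembly: `H²(J)` is finitely generated -/

section H2Ideal

open IsLocalRing RingTheory.Sequence

/-- **Finiteness of `H²_𝔪(J)`** (Čech, position `2`) for an ideal `J` of a Noetherian local ring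
`R` admitting an `R`-regular sequence of length `≥ 3` in `𝔪 ⊆ √(y)`, when `J` contains a regular
element, is principal at every non-maximal prime and is `𝔪`-saturated. (Special case of
Grothendieck's finiteness theorem SGA 2 VIII 2.3, proved here elementarily: the trace ideal of
`J` is `𝔪`-primary and kills `H²(J)`; for `x ∈ 𝔪` regular on `R` and `R/J`, the `x`-torsion of
`H²(J)` comes from `Z⁰(J/xJ) ↪ Z⁰(R/xR) ≅ R/xR`.) [folklore] -/
theorem Module.finite_H2_ideal [IsLocalRing R] [IsNoetherianRing R] (J : Ideal R)
    (hreg : ∃ c ∈ J, c ∈ nonZeroDivisors R)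
    (hloc : ∀ (Q : Ideal R) [Q.IsPrime], ¬ Q.IsMaximal →
      (J.map (algebraMap R (Localization.AtPrime Q))).IsPrincipal)
    (hsat : ∀ b : R, (∀ x : R, ¬ IsUnit x → x * b ∈ J) → b ∈ J)
    (hrad : ∀ r ∈ maximalIdeal R, r ∈ (Ideal.span (Set.range y)).radical)
    (rs : List R) (hrs : IsRegular R rs) (hlen : 3 ≤ rs.length)
    (hmem : ∀ r ∈ rs, r ∈ maximalIdeal R) :
    Module.Finite R (H2 (y := y) (M := J)) := by
  -- exactness of `Č(R)` in positions `0, 1, 2`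
  obtain ⟨hR0, -, hR2⟩ := cech_exact_of_isRegular (y := y) rs R hrs fun r hr => hrad r (hmem r hr)
  have hR0' := hR0 (by omega)
  have hR2' := hR2 0 (by omega)
  -- `x ∈ 𝔪` regular on `R` and on `R ⧸ J`
  obtain ⟨x₁, rs₁, rfl⟩ : ∃ x₁ rs₁, rs = x₁ :: rs₁ := by
    cases rs with
    | nil => simp at hlen
    | cons a l => exact ⟨a, l, rfl⟩
  have hx₁ : IsSMulRegular R x₁ := ((isRegular_cons_iff R x₁ rs₁).mp hrs).1
  have hnt1 : ∀ r : R, (∀ x ∈ maximalIdeal R, x • r = 0) → r = 0 := fun r hr =>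
    hx₁.right_eq_zero_of_smul (hr x₁ (hmem x₁ (by simp)))
  have hnt2 : ∀ r : R ⧸ J, (∀ x ∈ maximalIdeal R, x • r = 0) → r = 0 := by
    intro r hr
    obtain ⟨b, rfl⟩ := Ideal.Quotient.mk_surjective r
    refine Ideal.Quotient.eq_zero_iff_mem.mpr (hsat b fun x hx => ?_)
    have := hr x ((mem_maximalIdeal x).mpr hx)
    rwa [Algebra.smul_def, Ideal.Quotient.algebraMap_eq, ← map_mul,
      Ideal.Quotient.eq_zero_iff_mem] at this
  obtain ⟨x, hxm, hxR, hxRJ⟩ :=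
    exists_isSMulRegular_both (R := R) (M₁ := R) (M₂ := R ⧸ J) hnt1 hnt2
  -- `x^c` kills `H²(J)`: the trace ideal is `𝔪`-primary
  obtain ⟨c, hc⟩ := exists_pow_maximalIdeal_le_span_hom J hreg hloc
  have hxc : ∀ e : H2 (y := y) (M := J), x ^ c • e = 0 :=
    pow_smul_H2_eq_zero_of_mem_span hR2' J (hc (Ideal.pow_mem_pow hxm c))
  -- `Z⁰(J/xJ)` is finitely generated: `J/xJ ↪ R/xR`, and `Č(R/xR)` is exact in positions `0, 1`
  obtain ⟨rs', hlen', hmem', hrs'⟩ :=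
    Literature.AlgebraicGeometry.Resolution.exists_isRegular_quotSMulTop hrs hmem hxR hxm
  obtain ⟨hP0, hP1, -⟩ := cech_exact_of_isRegular (y := y) rs' (QuotSMulTop x R) hrs'
    fun r hr => hrad r (hmem' r hr)
  have hlen'' : 1 < rs'.length := by
    simp only [List.length_cons] at hlen' hlen
    omega
  have hZ0 : Module.Finite R (LinearMap.ker (dC (y := y) (M := QuotSMulTop x J) 0)) :=
    finite_ker_dC_zero_of_injective (QuotSMulTop.map x (Submodule.subtype J))
      (quotSMulTop_map_subtype_injective J hxRJ) (hP0 (by omega)) (hP1 hlen'')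
  exact Module.finite_H2 (IsSMulRegular.submodule J x hxR) hZ0 c hxc

end H2Ideal

end Literature.RingTheory.LocalCohomology

end
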